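import Summits.BirchSwinnertonDyer.BirchSwinnertonDyer.Theses.UniversalToricDescent
import Summits.BirchSwinnertonDyer.BirchSwinnertonDyer.Theorems.UniversalToricDescentToricTransportModThreeStubRatSqueeze
import Summits.BirchSwinnertonDyer.BirchSwinnertonDyer.Theorems.UniversalToricDescentRationalSplitIMCInclusionAtThreeOfWall
import HarnessLib

/-!
# Crux `AdditiveSplitIMCInclusionAtThree` (stmt-BirchSwinnertonDyer-20395) — node `eisenstein_adjoint_patching`
# (crux-ideate cover g18; UNREGISTERED node, `sorry` only in `stub_*`; concludes the crux BY NAME)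

THE WALL IN ANNIHILATOR CURRENCY.  Every earlier node reads the surplus of the wall over RATWALL (24207) as a
`μ`-statement on the ALGEBRAIC side (`μ(X_(∅,0)) = 0`: g7 `wall_iff_ratwall_and_muDominance`, g8/g10/g14/g17
`ResidualSelmerFinite…`) and then hunts for a SOURCE of algebraic `μ = 0` (twin 24737, teeth, fine Selmer, symplectic
growth …) — every such source died or is open.  This node types the surplus instead as a RADICAL / ANNIHILATOR
statement that never mentions `μ`:

* **POWERWALL** (`PowerSplitIMCInclusionAtThree`): `∃ n, (ℒ_𝔭^{BDP})ⁿ ∈ Ch_Λ(X_(∅,0))·R₀⟦T⟧`, i.e. the generator `g`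
  of the (principal: `charIdeal_isPrincipal_holds`) characteristic ideal divides a POWER of `ℒ`.  This is exactly the
  output shape of ANNIHILATION / FITTING-IDEAL arguments (`ℒ·X = 0` with `X` generated by `n` elements ⟹
  `ℒⁿ ∈ Fitt₀(X) ⊆ Ch(X)`), and in particular of an `R^{red} = 𝕋` theorem for the residually REDUCIBLE Galois
  representation of Wan's semi-ordinary `U(3,1)` Klingen–Eisenstein family of `(f_E, K)` at `p = 3` — the UPPER-BOUND
  half of the Eisenstein method (Wake–Wang-Erickson / Berger–Klosin / Thorne shape), whose reducibility ideal surjects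
  onto `X_(∅,0) ⊗ R₀` (Bellaïche–Chenevier) and whose Eisenstein quotient `𝕋⁰/J` is `Λ_{R₀}/(ℒ^Σ)`.  Taylor–Wiles
  access to `X_(∅,0)` exists through `ad(ρ̄_Eis) ⊃ Hom(ψ̄, ρ̄_f ξ̄) ≅ ρ̄_f ⊗ χ̄` (the lineage's B-g11-1 parity veto concerns
  `ad(ρ_f)` of a PURE representation only).  See `Lines/eisenstein_adjoint_patching.md`, `Ideas/eisenstein-adjoint-patching.md`.
* **UNIT** (`BDPUnitCoefficientAtThree`): the BDP series of the frame has a coefficient of norm one (analytic `μ = 0`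
  in the crux's OWN normalisation: Hsieh 2014 Thm. B at any level + the Castella–Hsieh/LZZ frame comparison + "the
  predicate `IsBDPLFunction` pins `L` up to `R₀⟦T⟧ˣ`" (Weierstrass preparation in `R₀⟦T⟧`)).
* **RATWALL** (`RationalSplitIMCInclusionAtThree`, route crux 24207, LEAD line).

KERNEL (proved here, no case split, no torsion hypothesis): RATWALL ∧ POWERWALL ∧ UNIT ⟹ WALL —
`g ∣ 3ᵏ·ℒ`, `g ∣ ℒⁿ`, `3 ∤ ℒ` ⟹ `3 ∤ g` (`3 = C 3` prime in `R₀⟦T⟧`, `prime_C_three`) ⟹ `g ∣ ℒ`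
(`dvd_of_dvd_prime_pow_mul`).  Conversely WALL ⟹ POWERWALL with `n = 1` (`powerwall_of_wall`) and WALL ⟹ RATWALL
(landed `rationalSplitIMCInclusionAtThree_of_wall`), so POWERWALL is WEAKER than the crux and, given RATWALL ∧ UNIT,
carries exactly its `μ`-half (`g ∣ ℒⁿ ∧ 3 ∤ ℒ ⟹ 3 ∤ g`).

Piece tags: RATWALL — WEAKER · LEAD (thin comb); POWERWALL — WEAKER (strictly: `g = ℒ²` satisfies it, not the wall) ·
UNDECIDED · leaf IDEA-NEEDED→beyond print (`R^{red} = 𝕋^{Kling}_𝔪` by patching at `p = 3`, congruence-module control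
`#𝕋⁰/J ≤ #Λ/(ℒ^Σ)`); UNIT — WEAKER · ATTACKABLE-from-print (Hsieh14 Thm. B any level is a tree named fact; the
up-to-units pinning is Weierstrass preparation).  Shred check: 3 stubs, none restates the crux (POWERWALL and UNIT hold
for `g = ℒ²`, resp. are `L`-only; RATWALL is a route crux).  Disproof.lean: none on file for 20395 (checked g18).
Negatives 15532 / 24881: disjoint vocabulary.
-/

set_option linter.dupNamespace false
set_option autoImplicit false

noncomputable section

open scoped Classical NumberField
open NumberField IsDedekindDomain Field WeierstrassCurve
open Literature.NumberTheory.EllipticCurves Literature.NumberTheory.EllipticCurves.IwasawaAlgebra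
open Literature.NumberTheory.EllipticCurves.ZpExtension
open Summit.BirchSwinnertonDyer.Rank1Residual.X11b Summit.BirchSwinnertonDyer.Rank1Residual.X11b.AcSelmer
open Summit.BirchSwinnertonDyer.BirchSwinnertonDyer.Theses.UniversalToricDescent
  (RationalSplitIMCInclusionAtThree AdditiveSplitIMCInclusionAtThree)
open Summit.BirchSwinnertonDyer.BirchSwinnertonDyer.Cruxes.ToricTransportModThree.RatwallThinComb
  (dvd_of_dvd_prime_pow_mul prime_C_three not_C_three_dvd_of_norm_coeff_eq_one)

namespace Summit.BirchSwinnertonDyer.BirchSwinnertonDyer.Cruxes.AdditiveSplitIMCInclusionAtThree.EisensteinAdjointPatching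

/-! ## §1 The pieces (Props over existing declarations; binders = the crux's) -/

/-- **POWERWALL** (WEAKER than the wall; UNDECIDED): on every frame of the crux, some POWER of the BDP series lies in
`Ch_Λ(X_(∅ at 𝔭, 0 at 𝔭′))·R₀⟦T⟧`.  The output currency of annihilator / Fitting-ideal / `R^{red} = 𝕋` arguments
(`ℒ·(X ⊗ R₀) = 0`, `X` generated by `n` elements ⟹ `ℒⁿ ∈ Fitt₀ ⊆ Ch`).
[cite: BergerKlosin2013, §6.4 (arXiv:1103.5100 p. 15)] [cite: Wan2020RankinSelberg, Thm. 1.1 (arXiv:1412.1767)] -/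
def PowerSplitIMCInclusionAtThree : Prop :=
  ∀ (W : WeierstrassCurve ℚ) [W.IsElliptic] [W.IsGloballyMinimal] (N : ℕ) [NeZero N]
    (K : Type) [Field K] [NumberField K]
    (Dt : Literature.NumberTheory.EllipticCurves.ModularForms.ModularParametrizationData W N),
    Summit.BirchSwinnertonDyer.Rank1Residual.Additive.ClassO6 W 3 → W.HasSurjectiveModNGaloisRep 3 →
    W.analyticRank = 1 → W.conductorNorm ℤ = N →
    IsImaginaryQuadratic K → SatisfiesHeegnerHypothesis N K →
    ∀ (κ : ZpExtension K 3), κ.IsAnticyclotomic →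
    ∀ (γ : absoluteGaloisGroup K) [Fact (κ.IsTopGenerator γ)]
      (𝔭 : HeightOneSpectrum (𝓞 K)), ((3 : ℕ) : 𝓞 K) ∈ 𝔭.asIdeal →
      𝔭.asIdeal.ramificationIdx (𝓞 ℚ) = 1 → 𝔭.asIdeal.inertiaDeg (𝓞 ℚ) = 1 →
    ∀ (𝔭' : HeightOneSpectrum (𝓞 K)), ((3 : ℕ) : 𝓞 K) ∈ 𝔭'.asIdeal → 𝔭' ≠ 𝔭 →
    ∀ (ι' : PadicAlgCl 3 ≃+* ℂ),
      Summit.BirchSwinnertonDyer.BirchSwinnertonDyer.Theorems.SchneiderFree.BranchInducesPrime 3 ι' 𝔭 →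
    ∀ (ΩK : ℂ) (Ωp : ℂ_[3]) (L : UnrSeries 3), ΩK ≠ 0 → Ωp ≠ 0 →
      IsBDPLFunction ι' 𝔭 κ γ Dt.f ΩK Ωp L →
      ∃ n : ℕ, Ideal.span {L ^ n} ≤
        (XAc.charIdeal (W.baseChange K) 3 κ 𝔭' ∅ γ).map (PowerSeries.map (Halves.toUnr 3))

/-- **UNIT** (WEAKER than the wall's analytic input; ATTACKABLE from print): on every frame of the crux the BDP series
has a coefficient of `3`-adic norm one — `μ(ℒ_𝔭^{BDP}) = 0` in the crux's own normalisation (Hsieh 2014 Thm. B at any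
level, transported through the Castella–Hsieh / Liu–Zhang–Zhang comparison; the predicate pins `L` up to a unit of
`R₀⟦T⟧` by Weierstrass preparation, so the period binders do not matter).
[cite: Hsieh2014, Thm. B] [cite: CastellaHsieh2018, §3.3 Prop. 3.6] [cite: LiuZhangZhang2018, Thm. 1.1] -/
def BDPUnitCoefficientAtThree : Prop :=
  ∀ (W : WeierstrassCurve ℚ) [W.IsElliptic] [W.IsGloballyMinimal] (N : ℕ) [NeZero N]
    (K : Type) [Field K] [NumberField K]
    (Dt : Literature.NumberTheory.EllipticCurves.ModularForms.ModularParametrizationData W N),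
    Summit.BirchSwinnertonDyer.Rank1Residual.Additive.ClassO6 W 3 → W.HasSurjectiveModNGaloisRep 3 →
    W.analyticRank = 1 → W.conductorNorm ℤ = N →
    IsImaginaryQuadratic K → SatisfiesHeegnerHypothesis N K →
    ∀ (κ : ZpExtension K 3), κ.IsAnticyclotomic →
    ∀ (γ : absoluteGaloisGroup K) [Fact (κ.IsTopGenerator γ)]
      (𝔭 : HeightOneSpectrum (𝓞 K)), ((3 : ℕ) : 𝓞 K) ∈ 𝔭.asIdeal →
      𝔭.asIdeal.ramificationIdx (𝓞 ℚ) = 1 → 𝔭.asIdeal.inertiaDeg (𝓞 ℚ) = 1 →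
    ∀ (ι' : PadicAlgCl 3 ≃+* ℂ),
      Summit.BirchSwinnertonDyer.BirchSwinnertonDyer.Theorems.SchneiderFree.BranchInducesPrime 3 ι' 𝔭 →
    ∀ (ΩK : ℂ) (Ωp : ℂ_[3]) (L : UnrSeries 3), ΩK ≠ 0 → Ωp ≠ 0 →
      IsBDPLFunction ι' 𝔭 κ γ Dt.f ΩK Ωp L →
      ∃ i : ℕ, ‖((PowerSeries.coeff i L : unrIntegers 3) : ℂ_[3])‖ = 1

/-! ## §2 Kernel algebra in `R₀⟦T⟧` (proved) -/

/-- If `g ∣ Lⁿ` and `3 ∤ L` then `3 ∤ g` (`3 = C 3` is prime in `R₀⟦T⟧`). [folklore] -/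
theorem not_C_three_dvd_of_dvd_pow {g L : UnrSeries 3} {n : ℕ} (hpow : g ∣ L ^ n)
    (hL : ¬ (PowerSeries.C ((3 : ℕ) : unrIntegers 3) : UnrSeries 3) ∣ L) :
    ¬ (PowerSeries.C ((3 : ℕ) : unrIntegers 3) : UnrSeries 3) ∣ g :=
  fun h ↦ hL (prime_C_three.dvd_of_dvd_pow (dvd_trans h hpow))

/-- **Radical squeeze**: `g ∣ 3ᵏ·L`, `g ∣ Lⁿ`, `3 ∤ L` ⟹ `g ∣ L`. [folklore] -/
theorem dvd_of_dvd_pow_of_dvd_prime_pow_mul {g L : UnrSeries 3} {k n : ℕ}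
    (hk : g ∣ (PowerSeries.C ((3 : ℕ) : unrIntegers 3) : UnrSeries 3) ^ k * L) (hpow : g ∣ L ^ n)
    (hL : ¬ (PowerSeries.C ((3 : ℕ) : unrIntegers 3) : UnrSeries 3) ∣ L) : g ∣ L :=
  dvd_of_dvd_prime_pow_mul prime_C_three (not_C_three_dvd_of_dvd_pow hpow hL) k hk

/-- The mapped characteristic ideal of `X_(∅,0)` is principal (no torsion hypothesis: `Λ = ℤ₃⟦T⟧` is a UFD, tree
`charIdeal_isPrincipal_holds`). [cite: Washington1997, §13.2] -/
theorem exists_map_charIdeal_eq_span {K : Type} [Field K] [NumberField K] (W : WeierstrassCurve K) [W.IsElliptic]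
    (κ : ZpExtension K 3) (𝔭' : HeightOneSpectrum (𝓞 K)) (γ : absoluteGaloisGroup K) [Fact (κ.IsTopGenerator γ)] :
    ∃ g : UnrSeries 3,
      (XAc.charIdeal W 3 κ 𝔭' ∅ γ).map (PowerSeries.map (Halves.toUnr 3)) = Ideal.span {g} := by
  have hP : (XAc.charIdeal W 3 κ 𝔭' ∅ γ).IsPrincipal := charIdeal_isPrincipal_holds 3 (XAc W 3 κ 𝔭' ∅ γ)
  obtain ⟨f, hf⟩ := hP
  refine ⟨PowerSeries.map (Halves.toUnr 3) f, ?_⟩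
  rw [hf, Ideal.submodule_span_eq, Ideal.map_span, Set.image_singleton]

/-! ## §3 KERNEL: RATWALL ∧ POWERWALL ∧ UNIT ⟹ WALL (proved; concludes the crux BY NAME) -/

/-- **The wall from RATWALL + POWERWALL + UNIT** (kernel).
[cite: Washington1997, §13.2] [cite: BergerKlosin2013, §6.4 (arXiv:1103.5100 p. 15)] -/
theorem wall_of_ratwall_of_powerwall_of_unit :
    RationalSplitIMCInclusionAtThree → PowerSplitIMCInclusionAtThree → BDPUnitCoefficientAtThree →
      AdditiveSplitIMCInclusionAtThree := by
  intro hR hP hU W _ _ N _ K _ _ Dt hO6 hsurj hr1 hN hK hH κ hκ γ _ 𝔭 h3 he hf 𝔭' h3' hne ι' hι ΩK Ωp L hΩK hΩp hL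
  obtain ⟨k, hk⟩ := hR W N K Dt hO6 hsurj hr1 hN hK hH κ hκ γ 𝔭 h3 he hf 𝔭' h3' hne ι' hι ΩK Ωp L hΩK hΩp hL
  obtain ⟨n, hn⟩ := hP W N K Dt hO6 hsurj hr1 hN hK hH κ hκ γ 𝔭 h3 he hf 𝔭' h3' hne ι' hι ΩK Ωp L hΩK hΩp hL
  obtain ⟨i, hi⟩ := hU W N K Dt hO6 hsurj hr1 hN hK hH κ hκ γ 𝔭 h3 he hf ι' hι ΩK Ωp L hΩK hΩp hL
  obtain ⟨g, hg⟩ := exists_map_charIdeal_eq_span (W.baseChange K) κ 𝔭' γ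
  rw [hg] at hk hn ⊢
  have hdvd : g ∣ ((3 : ℕ) : UnrSeries 3) ^ k * L := Ideal.mem_span_singleton.mp hk
  rw [← map_natCast (PowerSeries.C (R := unrIntegers 3))] at hdvd
  have hpow : g ∣ L ^ n := Ideal.span_singleton_le_span_singleton.mp hn
  exact Ideal.span_singleton_le_span_singleton.mpr
    (dvd_of_dvd_pow_of_dvd_prime_pow_mul hdvd hpow (not_C_three_dvd_of_norm_coeff_eq_one hi))

/-- Converse bookkeeping (proved): the wall gives POWERWALL back with `n = 1`, so POWERWALL is WEAKER than the crux.
[cite: Washington1997, §13.2] -/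
theorem powerwall_of_wall : AdditiveSplitIMCInclusionAtThree → PowerSplitIMCInclusionAtThree := by
  intro h W _ _ N _ K _ _ Dt hO6 hsurj hr1 hN hK hH κ hκ γ _ 𝔭 h3 he hf 𝔭' h3' hne ι' hι ΩK Ωp L hΩK hΩp hL
  have hw := h W N K Dt hO6 hsurj hr1 hN hK hH κ hκ γ 𝔭 h3 he hf 𝔭' h3' hne ι' hι ΩK Ωp L hΩK hΩp hL
  exact ⟨1, by simpa only [pow_one] using hw⟩

/-- Converse bookkeeping (landed): the wall gives RATWALL back. [cite: Washington1997, §13.2] -/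
theorem ratwall_of_wall : AdditiveSplitIMCInclusionAtThree → RationalSplitIMCInclusionAtThree :=
  Summit.BirchSwinnertonDyer.BirchSwinnertonDyer.Theorems.UniversalToricDescentRationalSplitIMCInclusionAtThreeOfWall.rationalSplitIMCInclusionAtThree_of_wall

/-- POWERWALL does not see `μ` on its own: `g ∣ Lⁿ` is compatible with `3 ∣ g` when `3 ∣ L`; the `μ`-content enters
only together with UNIT (in-file record of the piece's logical position; trivial). [folklore] -/
theorem powerwall_shape_example (L : UnrSeries 3) : L ^ 2 ∣ L ^ 2 := dvd_rfl

/-! ## §4 The three stubs of the node (the ONLY `sorry`s of this file) -/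

/-- RATWALL (route crux 24207, WEAKER than the wall; LEAD line `thin_comb`). -/
theorem stub_ratwall : RationalSplitIMCInclusionAtThree := by
  sorry

/-- POWERWALL — annihilator/radical currency of the `μ`-half (WEAKER; UNDECIDED; supply: `R^{red} = 𝕋^{Kling}`
upper bound for Wan's semi-ordinary `U(3,1)` family at `p = 3`, IDEA `eisenstein-adjoint-patching`). -/
theorem stub_powerwall : PowerSplitIMCInclusionAtThree := by
  sorry

/-- UNIT — analytic `μ = 0` of the frame's BDP series (WEAKER; ATTACKABLE from print). -/
theorem stub_bdpUnitCoefficient : BDPUnitCoefficientAtThree := by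
  sorry

/-! ## §5 TOP composition: the crux BY NAME -/

/-- **The wall from RATWALL + POWERWALL + UNIT.**  Concludes `AdditiveSplitIMCInclusionAtThree` BY NAME.
[cite: Washington1997, §13.2] -/
theorem AdditiveSplitIMCInclusionAtThree_of :
    RationalSplitIMCInclusionAtThree → PowerSplitIMCInclusionAtThree → BDPUnitCoefficientAtThree →
      AdditiveSplitIMCInclusionAtThree :=
  wall_of_ratwall_of_powerwall_of_unit

/-- The top composition run on the stubs: the crux BY NAME (sorries only through `stub_*`). -/
theorem AdditiveSplitIMCInclusionAtThree_holds_of_stubs : AdditiveSplitIMCInclusionAtThree :=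
  AdditiveSplitIMCInclusionAtThree_of stub_ratwall stub_powerwall stub_bdpUnitCoefficient

end Summit.BirchSwinnertonDyer.BirchSwinnertonDyer.Cruxes.AdditiveSplitIMCInclusionAtThree.EisensteinAdjointPatching

end
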